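import Summits.Ventures.YMGap.Thresholds.SharpClusteringTorus
import Summits.Ventures.YMGap.Thresholds.SharpClusteringLimit
import Summits.Ventures.YMGap.Thresholds.SharpUniqueness
import HarnessLib

/-!
# Venture YMGap — static exponential clustering, Part IV-d:
# the named fact `shenZhuZhu_massGap_transfer` is a theorem

HONEST FRAMING: venture file (cell `pub-ymgap`, track (a), seat lit-1). Lattice `SU(N)` Yang–Mills at
strong coupling ('t Hooft `|β| < 1/(2Λ₀)` for a torus Hessian constant `Λ₀` of the tree); nothing about
the continuum or physical weak coupling.

This file closes the R119 line of the cell: the Literature named fact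
`shenZhuZhu_massGap_transfer d N` (Shen–Zhu–Zhu, CMP 400 (2023), Cor. 4.11 with the Hessian constant as
a parameter — "Poincaré/Bakry–Émery with constant `K = N/2 - N|β|Λ₀ > 0` ⇒ exponential clustering of
every tight limit") is PROVED, by a static argument that replaces the paper's Langevin-semigroup proof:
the weighted Bochner inequality (`SharpClusteringBochner`, Part I), the weighted energy estimate
(`SharpClusteringEnergy`), `H¹`-approximate solvability of the Poisson equation via the ground-state
transform and the venture's kernel ground-state theorem (`SharpClustering{Sobolev,WeakGrad,PoissonA,
PoissonB,Density}`, Part II), the weighted covariance identity (`SharpClusteringCovariance`,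
`SharpClusteringDecay`, Part III), the torus instance with seat ds-2's termwise Wilson Hessian brick
(`SharpClusteringWilson{Words,}`, `SharpClusteringTorus`, Part IV-a) and seat ds-2's passage to
tight limits and Lipschitz cylinder functions (`SharpClusteringSmooth/LimitPrep/Limit`, Part IV-b).

Consequences recorded here: the venture's conditional sharp-window theorems lose this hypothesis —
`ImprovedThreshold d N (1/(8d))` for `d ≥ 3`, `N ≥ 2` now depends on DLR uniqueness at the sharp
window only (`improvedThreshold_sharp_of_uniqueness`), i.e. on the two log-Sobolev facts of
`SharpUniqueness` (`improvedThreshold_sharp_of_logSobolev`), no longer on three.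

## References

* H. Shen, R. Zhu, X. Zhu, CMP 400 (2023) 805–851, §4.3, Cor. 4.11 / Remark 4.12.
-/

noncomputable section

open Literature.MathematicalPhysics.QuantumFieldTheory

namespace Summit.Ventures.YMGap

namespace SharpClustering

section Discharge

variable (d N : ℕ)

/-- **Shen–Zhu–Zhu's mass-gap step with the Hessian constant as a parameter is a theorem**: for
every torus Hessian constant `Λ₀` (`WilsonHessianBound d N Λ₀`), `d, N ≥ 2`, and every 't Hooft
coupling with `N/2 - N|β|Λ₀ > 0`, every tight limit of the torus states at tree coupling `Nβ`
clusters exponentially (`SZZExponentialClustering d N β`). Static proof: Parts I–IV of the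
`SharpClustering*` files (seats lit-1 and ds-2 of the cell). Stated over the fact's own
parameters `d N` (section variables), with no hypothesis binders. -/
theorem shenZhuZhu_massGap_transfer_holds : shenZhuZhu_massGap_transfer d N := by
  intro Λ₀ _ hH _ hN β hK
  obtain ⟨κ, hκ, hT⟩ := torus_covariance_exp_decay hH (by omega) β hK
  exact szzExponentialClustering_of_torusDecay β (div_pos two_pos hK).le hκ hT

end Discharge

/-- **The sharp-window target type, conditional on DLR uniqueness only**: for `d ≥ 3`, `N ≥ 2`,
`SharpUniqueness d N → ImprovedThreshold d N (1/(8d))` (the transfer hypothesis of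
`HessianSharp.improvedThreshold_sharp_of_uniqueness` is discharged). -/
theorem improvedThreshold_sharp_of_uniqueness {d N : ℕ} (hu : HessianSharp.SharpUniqueness d N)
    (hd : 3 ≤ d) (hN : 2 ≤ N) : ImprovedThreshold d N (HessianSharp.sharpThresholdSU d) :=
  HessianSharp.improvedThreshold_sharp_of_uniqueness (shenZhuZhu_massGap_transfer_holds d N) hu hd hN

/-- **The sharp-window target type from the two log-Sobolev facts** (`bakryEmery_kernelLogSobolev`,
`stroockZegarlinski_uniqueness`; the third hypothesis of `HessianSharp.improvedThreshold_sharp` is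
discharged): `ImprovedThreshold d N (1/(8d))` for `d ≥ 3`, `N ≥ 2`. -/
theorem improvedThreshold_sharp_of_logSobolev {d N : ℕ} (h₁ : bakryEmery_kernelLogSobolev d N)
    (h₂ : stroockZegarlinski_uniqueness d N) (hd : 3 ≤ d) (hN : 2 ≤ N) :
    ImprovedThreshold d N (HessianSharp.sharpThresholdSU d) :=
  HessianSharp.improvedThreshold_sharp h₁ h₂ (shenZhuZhu_massGap_transfer_holds d N) hd hN

end SharpClustering

end Summit.Ventures.YMGap
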